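import Mathlib
import Summits.Ventures.HodgeRepro2.T6A1Glue

/-!
# T6A1EigenGen — canonical eigenline generators `e_{i,σ}` of `H¹(B, ℂ)` (TIER4 (A0.4), (A0.6))

Tier-6 sub-goal A1 (route/T6-A1-t6-p1.md; TARGET-T6.md §2 Layer II). The M2-final statement
`HCCMOfPublished₂` (T6MainM2Stmt) carries the eigenline generators of the N side as a DATA binder
`e : (K →+* ℂ) → Fin 4 → H1C K` together with the RESIDUAL binder `e_mem : ∀ σ i, e σ i ∈ eigenLine K i σ`
(route/T6-RESIDUAL-LEDGER-p3.md rows 14–15; TIER5 (N0.2)(q3)–(q5)). This file supplies a CANONICAL such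
family from the landed A1 eigenvector theorem `A1Glue.exists_eigenvectors` (TIER4 (A0.4):
`K ⊗ ℂ = ⊕_σ ℂ·v σ`): `eGen K σ i = single i (v σ)` lies in `eigenLine K i σ`, is non-zero, and spans it
(the generators `e_{i,σ}` of TIER4 (A0.6), Lemma A0.5). No display and no hypothesis: every statement is a
theorem of the tree (axioms: the trio, through `Classical.choose`). Proof lane; sole filer t6-p1.
-/

namespace Summit.Ventures.HodgeRepro2.T6.A1EigenGen

variable (K : Type*) [Field K] [NumberField K]

/-- A chosen family of non-zero eigenvectors `v σ ∈ K ⊗ ℂ`, one per embedding `σ`, with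
`eigenLineK K σ = ℂ · v σ` and spanning `K ⊗ ℂ` (`A1Glue.exists_eigenvectors`, TIER4 (A0.4)). -/
noncomputable def vGen : (K →+* ℂ) → KC K := Classical.choose (A1Glue.exists_eigenvectors K)

/-- The defining properties of `vGen`: non-zero, spanning each eigenline, spanning `K ⊗ ℂ`. -/
theorem vGen_spec :
    (∀ σ, vGen K σ ≠ 0) ∧ (∀ σ, eigenLineK K σ = Submodule.span ℂ {vGen K σ}) ∧
      Submodule.span ℂ (Set.range (vGen K)) = ⊤ :=
  Classical.choose_spec (A1Glue.exists_eigenvectors K)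

/-- `v σ ≠ 0`. -/
theorem vGen_ne_zero (σ : K →+* ℂ) : vGen K σ ≠ 0 := (vGen_spec K).1 σ

/-- `eigenLineK K σ = ℂ · v σ`: the `σ`-eigenline of `K ⊗ ℂ` is the line spanned by `v σ`. -/
theorem eigenLineK_eq_span_vGen (σ : K →+* ℂ) :
    eigenLineK K σ = Submodule.span ℂ {vGen K σ} := (vGen_spec K).2.1 σ

/-- `v σ` lies in the `σ`-eigenline of `K ⊗ ℂ`. -/
theorem vGen_mem_eigenLineK (σ : K →+* ℂ) : vGen K σ ∈ eigenLineK K σ := by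
  rw [eigenLineK_eq_span_vGen]
  exact Submodule.mem_span_singleton_self _

/-- The `v σ` span `K ⊗ ℂ` (`K ⊗ ℂ = ⊕_σ ℂ·v σ`). -/
theorem span_range_vGen : Submodule.span ℂ (Set.range (vGen K)) = ⊤ := (vGen_spec K).2.2

/-- The canonical eigenline generators `e_{i,σ} = single i (v σ) ∈ H¹(B, ℂ)` of TIER4 (A0.6): the
`σ`-eigenvector of the `i`-th vertex, the shape of the M2-final's data binder `e`. -/
noncomputable def eGen (σ : K →+* ℂ) (i : Fin 4) : H1C K :=
  LinearMap.single ℂ (fun _ : Fin 4 => KC K) i (vGen K σ)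

/-- `e_{i,σ} ∈ ℓ_{i,σ}`: the residual `e_mem` of the M2-final (route/T6-RESIDUAL-LEDGER-p3.md row 15) for
the canonical family, as a theorem. -/
theorem eGen_mem (σ : K →+* ℂ) (i : Fin 4) : eGen K σ i ∈ eigenLine K i σ :=
  Submodule.mem_map_of_mem (vGen_mem_eigenLineK K σ)

/-- The `i`-th component of `e_{i,σ}` is `v σ`. -/
theorem eGen_apply_self (σ : K →+* ℂ) (i : Fin 4) : eGen K σ i i = vGen K σ := by
  simp [eGen]

/-- `e_{i,σ} ≠ 0`: the canonical generators are non-zero (non-degeneracy of the datum). -/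
theorem eGen_ne_zero (σ : K →+* ℂ) (i : Fin 4) : eGen K σ i ≠ 0 := by
  intro h
  have hi : eGen K σ i i = 0 := by rw [h]; rfl
  rw [eGen_apply_self] at hi
  exact vGen_ne_zero K σ hi

/-- `ℓ_{i,σ} = ℂ · e_{i,σ}`: each eigenline of `H¹(B, ℂ)` is the line spanned by its canonical generator
(TIER4 Lemma A0.5: the `ℓ_{i,σ}` are lines). -/
theorem eigenLine_eq_span_eGen (σ : K →+* ℂ) (i : Fin 4) :
    eigenLine K i σ = Submodule.span ℂ {eGen K σ i} := by
  unfold eigenLine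
  rw [eigenLineK_eq_span_vGen, Submodule.map_span, Set.image_singleton]
  rfl

end Summit.Ventures.HodgeRepro2.T6.A1EigenGen
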